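import Literature.Analysis.Complex.StripContourShift
import Mathlib.Analysis.SpecialFunctions.ImproperIntegrals
import Mathlib.Analysis.Calculus.DSlope
import Mathlib.Analysis.Complex.RemovableSingularity
import Mathlib.MeasureTheory.Measure.Haar.NormedSpace
import Mathlib.MeasureTheory.Group.Integral
import HarnessLib

/-!
# Cauchy's theorem and Cauchy's integral formula for a half-plane, as integrals over `ℝ`

Topic `Literature/Analysis/Complex` (contour integration; everything here is PROVED, no definition,
no named fact). For a function `h` continuous on the closed upper half-plane `{Im z ≥ 0}`,
holomorphic on the open one and small at infinity there, the integral of `h` over the boundary line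
`ℝ` behaves as the integral over a closed contour:

* `integral_eq_zero_of_upperHalfPlane` (Cauchy–Goursat): if `‖h z‖ ≤ C/‖z‖²` for `Im z ≥ 0`,
  `‖z‖ ≥ R₀`, then `∫_ℝ h(x) dx = 0`; `integral_eq_zero_of_lowerHalfPlane` is the mirror image.
  Proof: the tree's strip shift `Literature.Analysis.Complex.integral_eq_integral_add_mul_I_of_strip`
  gives `∫ h(x) dx = ∫ h(x + iY) dx` for every `Y ≥ 0`, and the right side tends to `0`
  (dominated convergence).
* `integral_div_sub_eq_of_upperHalfPlane` (Cauchy's integral formula): if `‖h z‖ ≤ C/‖z‖` for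
  `Im z ≥ 0`, `‖z‖ ≥ R₀`, and `Im w > 0`, then `∫_ℝ h(x)/(x − w) dx = 2πi h(w)`. Proof: apply the
  first statement to `dslope m w`, `m(z) = h(z) − h(w)(w − w̄)/(z − w̄)`, and use
  `∫ dx/((x − w)(x − w̄)) = π/Im w`.

These are the unbounded-contour forms of Cauchy's theorem used when a Taylor remainder is written as
a Cauchy integral over a straight line (e.g. Arias de Reyna, Math. Comp. 80 (2011), proof of Thm. 4.2,
the line `L` through `1/2` of direction `e^{iπ/4}`; see
`Literature/NumberTheory/LFunctions/AriasDeReynaKernel.lean`). Standard textbook material.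

## References

* L. V. Ahlfors, *Complex Analysis*, 3rd ed., McGraw-Hill (1979): Ch. 4 §1.4 Thm. 2 (Cauchy's theorem
  for a rectangle), Ch. 4 §2.2 Thm. 6 (Cauchy's integral formula), Ch. 4 §5.3 (evaluation of
  `∫_{-∞}^{∞}` by closing the contour in a half-plane). [AhlforsCA1979]
-/

noncomputable section

open MeasureTheory Set Filter Complex
open scoped Topology Real ComplexConjugate

namespace Literature.Analysis.Complex

/-! ### A decay bound on the closed half-plane from continuity and decay at infinity -/

/-- If `h` is continuous on the closed upper half-plane and `‖h z‖ ≤ C/‖z‖²` there for `‖z‖ ≥ R₀`,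
then `‖h z‖ ≤ B/(1 + ‖z‖²)` on the whole closed upper half-plane for some `B ≥ 0`. [folklore] -/
private lemma exists_bound_div_one_add_sq_of_upperHalfPlane {h : ℂ → ℂ} {C R₀ : ℝ}
    (hc : ContinuousOn h {z : ℂ | 0 ≤ z.im})
    (hb : ∀ z : ℂ, 0 ≤ z.im → R₀ ≤ ‖z‖ → ‖h z‖ ≤ C / ‖z‖ ^ 2) :
    ∃ B : ℝ, 0 ≤ B ∧ ∀ z : ℂ, 0 ≤ z.im → ‖h z‖ ≤ B / (1 + ‖z‖ ^ 2) := by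
  set R₁ : ℝ := max R₀ 1 with hR₁
  have hR₁1 : 1 ≤ R₁ := le_max_right _ _
  have hR₁0 : R₀ ≤ R₁ := le_max_left _ _
  -- the compact part
  have hK : IsCompact ({z : ℂ | 0 ≤ z.im} ∩ Metric.closedBall (0 : ℂ) R₁) :=
    (isCompact_closedBall _ _).inter_left (isClosed_le continuous_const Complex.continuous_im)
  obtain ⟨M, hM⟩ := hK.exists_bound_of_continuousOn (hc.mono inter_subset_left)
  -- `C ≥ 0` (test at the real point `R₁`)
  have hC : 0 ≤ C := by
    have hR₁pos : (0 : ℝ) < R₁ := by linarith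
    have hnorm : ‖(R₁ : ℂ)‖ = R₁ := by simp [abs_of_pos hR₁pos]
    have h1 := hb (R₁ : ℂ) (by simp) (by rw [hnorm]; exact hR₁0)
    rw [hnorm] at h1
    have h2 : (0 : ℝ) ≤ C / R₁ ^ 2 := (norm_nonneg _).trans h1
    have h3 : 0 < R₁ ^ 2 := by positivity
    by_contra hneg
    have hneg' : C < 0 := lt_of_not_ge hneg
    have : C / R₁ ^ 2 < 0 := div_neg_of_neg_of_pos hneg' h3
    linarith
  have hM0 : 0 ≤ M := (norm_nonneg _).trans (hM 0 ⟨by simp, by simp; positivity⟩)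
  refine ⟨max (M * (1 + R₁ ^ 2)) (2 * C), le_max_of_le_right (by positivity), fun z hz ↦ ?_⟩
  have hpos : 0 < 1 + ‖z‖ ^ 2 := by positivity
  rw [le_div_iff₀ hpos]
  rcases le_or_gt ‖z‖ R₁ with hzR | hzR
  · have h1 : ‖h z‖ ≤ M := hM z ⟨hz, by simpa using hzR⟩
    calc ‖h z‖ * (1 + ‖z‖ ^ 2) ≤ M * (1 + R₁ ^ 2) := by
          apply mul_le_mul h1 _ hpos.le hM0
          nlinarith [norm_nonneg z]
      _ ≤ max (M * (1 + R₁ ^ 2)) (2 * C) := le_max_left _ _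
  · have hz1 : 1 ≤ ‖z‖ := hR₁1.trans hzR.le
    have hzpos : 0 < ‖z‖ ^ 2 := by positivity
    have h1 : ‖h z‖ ≤ C / ‖z‖ ^ 2 := hb z hz (hR₁0.trans hzR.le)
    rw [le_div_iff₀ hzpos] at h1
    calc ‖h z‖ * (1 + ‖z‖ ^ 2) ≤ ‖h z‖ * (2 * ‖z‖ ^ 2) := by
          apply mul_le_mul_of_nonneg_left _ (norm_nonneg _); nlinarith
      _ = 2 * (‖h z‖ * ‖z‖ ^ 2) := by ring
      _ ≤ 2 * C := by linarith
      _ ≤ max (M * (1 + R₁ ^ 2)) (2 * C) := le_max_right _ _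

/-! ### Cauchy–Goursat for the upper and the lower half-plane -/

/-- **Cauchy's theorem for the upper half-plane.** If `h` is continuous on `{Im z ≥ 0}`, holomorphic
on `{Im z > 0}` and `‖h z‖ ≤ C/‖z‖²` for `Im z ≥ 0`, `‖z‖ ≥ R₀`, then `∫_ℝ h(x) dx = 0` (Cauchy's theorem
for the rectangles `[-T, T] × [0, Y]`, `T → ∞`, then `Y → ∞`: the method of "closing the contour in
the upper half-plane"). [cite: AhlforsCA1979, Ch. 4 §5.3 (evaluation of `∫_{-∞}^{∞}` by closing in a half-plane) with Ch. 4 §1.4 Thm. 2] -/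
theorem integral_eq_zero_of_upperHalfPlane {h : ℂ → ℂ} {C R₀ : ℝ}
    (hc : ContinuousOn h {z : ℂ | 0 ≤ z.im}) (hd : DifferentiableOn ℂ h {z : ℂ | 0 < z.im})
    (hb : ∀ z : ℂ, 0 ≤ z.im → R₀ ≤ ‖z‖ → ‖h z‖ ≤ C / ‖z‖ ^ 2) :
    ∫ x : ℝ, h x = 0 := by
  obtain ⟨B, hB0, hB⟩ := exists_bound_div_one_add_sq_of_upperHalfPlane hc hb
  -- the dominator `b(x) = B/(1 + x²)`
  set b : ℝ → ℝ := fun x ↦ B * (1 + x ^ 2)⁻¹ with hbdef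
  have hbi : Integrable b := integrable_inv_one_add_sq.const_mul B
  have hsq : Tendsto (fun x : ℝ ↦ 1 + x ^ 2) atTop atTop :=
    tendsto_atTop_add_const_left _ _ (tendsto_pow_atTop two_ne_zero)
  have hsq' : Tendsto (fun x : ℝ ↦ 1 + x ^ 2) atBot atTop := by
    have : (fun x : ℝ ↦ 1 + x ^ 2) = (fun x : ℝ ↦ 1 + x ^ 2) ∘ Neg.neg := by
      funext x; simp
    rw [this]
    exact hsq.comp tendsto_neg_atBot_atTop
  have htop : Tendsto b atTop (𝓝 0) := by
    simpa using (tendsto_inv_atTop_zero.comp hsq).const_mul B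
  have hbot : Tendsto b atBot (𝓝 0) := by
    simpa using (tendsto_inv_atTop_zero.comp hsq').const_mul B
  have hbound : ∀ z : ℂ, 0 ≤ z.im → ‖h z‖ ≤ b z.re := by
    intro z hz
    have h1 := hB z hz
    have h2 : z.re ^ 2 ≤ ‖z‖ ^ 2 := by
      rw [Complex.sq_norm, Complex.normSq_apply]; nlinarith
    have h3 : 0 < 1 + z.re ^ 2 := by positivity
    calc ‖h z‖ ≤ B / (1 + ‖z‖ ^ 2) := h1
      _ ≤ B / (1 + z.re ^ 2) := div_le_div_of_nonneg_left hB0 h3 (by linarith)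
      _ = b z.re := by simp [hbdef, div_eq_mul_inv]
  -- the shift `∫ h(x) dx = ∫ h(x + iY) dx`
  have hshift : ∀ Y : ℝ, 0 ≤ Y → ∫ x : ℝ, h x = ∫ x : ℝ, h (x + Y * I) := by
    intro Y hY
    exact integral_eq_integral_add_mul_I_of_strip hY
      (hc.mono fun z hz ↦ hz.1) (hd.mono fun z hz ↦ hz.1)
      (fun z hz _ ↦ hbound z hz) hbi htop hbot
  -- the shifted integrals tend to `0`
  have hmeas : ∀ Y : ℝ, 0 ≤ Y → AEStronglyMeasurable (fun x : ℝ ↦ h (x + Y * I)) volume := by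
    intro Y hY
    refine (hc.comp_continuous (by fun_prop) fun x ↦ ?_).aestronglyMeasurable
    simp [hY]
  have hlim : Tendsto (fun Y : ℝ ↦ ∫ x : ℝ, h (x + Y * I)) atTop (𝓝 (∫ _x : ℝ, (0 : ℂ))) := by
    refine tendsto_integral_filter_of_dominated_convergence b ?_ ?_ hbi ?_
    · filter_upwards [eventually_ge_atTop (0 : ℝ)] with Y hY using hmeas Y hY
    · filter_upwards [eventually_ge_atTop (0 : ℝ)] with Y hY
      refine Eventually.of_forall fun x ↦ ?_
      have := hbound (x + Y * I) (by simp [hY])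
      simpa using this
    · refine Eventually.of_forall fun x ↦ ?_
      rw [tendsto_zero_iff_norm_tendsto_zero]
      have hup : ∀ᶠ Y : ℝ in atTop, ‖h (x + Y * I)‖ ≤ B * (1 + Y ^ 2)⁻¹ := by
        filter_upwards [eventually_ge_atTop (0 : ℝ)] with Y hY
        have h1 := hB (x + Y * I) (by simp [hY])
        have h2 : Y ^ 2 ≤ ‖(x : ℂ) + Y * I‖ ^ 2 := by
          rw [Complex.sq_norm, Complex.normSq_apply]; simp; nlinarith
        have h3 : 0 < 1 + Y ^ 2 := by positivity
        calc ‖h (x + Y * I)‖ ≤ B / (1 + ‖(x : ℂ) + Y * I‖ ^ 2) := h1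
          _ ≤ B / (1 + Y ^ 2) := div_le_div_of_nonneg_left hB0 h3 (by linarith)
          _ = B * (1 + Y ^ 2)⁻¹ := div_eq_mul_inv _ _
      refine squeeze_zero' (Eventually.of_forall fun Y ↦ norm_nonneg _) hup ?_
      simpa using (tendsto_inv_atTop_zero.comp hsq).const_mul B
  rw [integral_zero] at hlim
  have hconst : Tendsto (fun Y : ℝ ↦ ∫ x : ℝ, h (x + Y * I)) atTop (𝓝 (∫ x : ℝ, h x)) := by
    apply tendsto_const_nhds.congr'
    filter_upwards [eventually_ge_atTop (0 : ℝ)] with Y hY using hshift Y hY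
  exact tendsto_nhds_unique hconst hlim

/-- **Cauchy's theorem for the lower half-plane**: the mirror image of
`integral_eq_zero_of_upperHalfPlane`. [cite: AhlforsCA1979, Ch. 4 §5.3 with Ch. 4 §1.4 Thm. 2] -/
theorem integral_eq_zero_of_lowerHalfPlane {h : ℂ → ℂ} {C R₀ : ℝ}
    (hc : ContinuousOn h {z : ℂ | z.im ≤ 0}) (hd : DifferentiableOn ℂ h {z : ℂ | z.im < 0})
    (hb : ∀ z : ℂ, z.im ≤ 0 → R₀ ≤ ‖z‖ → ‖h z‖ ≤ C / ‖z‖ ^ 2) :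
    ∫ x : ℝ, h x = 0 := by
  have key := integral_eq_zero_of_upperHalfPlane (h := fun z ↦ h (-z)) (C := C) (R₀ := R₀)
    (hc.comp (by fun_prop) fun z hz ↦ by simpa using hz)
    (hd.comp (by fun_prop) fun z hz ↦ by simpa using hz)
    (fun z hz hR ↦ by simpa using hb (-z) (by simpa using hz) (by simpa using hR))
  have e := MeasureTheory.integral_neg_eq_self (fun y : ℝ ↦ h y) (volume : Measure ℝ)
  simp only [Complex.ofReal_neg] at e
  rw [e] at key
  exact key

/-! ### The elementary integral `∫ dx/((x − w)(x − w̄)) = π / Im w` -/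

/-- `(x − w)(x − w̄) = (x − Re w)² + (Im w)²` for real `x`. [folklore] -/
private lemma sub_mul_sub_conj (w : ℂ) (x : ℝ) :
    ((x : ℂ) - w) * ((x : ℂ) - conj w) = (((x - w.re) ^ 2 + w.im ^ 2 : ℝ) : ℂ) := by
  apply Complex.ext
  · simp [sq]
  · simp [sq]; ring

/-- `∫ dx / ((x − a)² + b²) = π/b` for `b > 0`. [folklore] -/
private lemma integral_inv_sq_add_sq {a b : ℝ} (hb : 0 < b) :
    ∫ x : ℝ, ((x - a) ^ 2 + b ^ 2)⁻¹ = π / b := by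
  have h1 : (∫ x : ℝ, ((x - a) ^ 2 + b ^ 2)⁻¹) = ∫ x : ℝ, (x ^ 2 + b ^ 2)⁻¹ := by
    have := integral_sub_right_eq_self (μ := (volume : Measure ℝ)) (fun x : ℝ ↦ (x ^ 2 + b ^ 2)⁻¹) a
    simpa using this
  have h2 : (fun x : ℝ ↦ (x ^ 2 + b ^ 2)⁻¹) = fun x : ℝ ↦ (b ^ 2)⁻¹ * (1 + (b⁻¹ * x) ^ 2)⁻¹ := by
    funext x
    have hb2 : b ^ 2 ≠ 0 := by positivity
    field_simp
    ring
  rw [h1, h2, integral_const_mul, MeasureTheory.Measure.integral_comp_inv_mul_left (fun y : ℝ ↦ (1 + y ^ 2)⁻¹) b,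
    integral_univ_inv_one_add_sq, abs_of_pos hb, smul_eq_mul]
  field_simp

/-- `∫ dx / ((x − w)(x − w̄)) = π / Im w` for `Im w > 0` (complex-valued form). [folklore] -/
private lemma integral_inv_sub_mul_sub_conj {w : ℂ} (hw : 0 < w.im) :
    ∫ x : ℝ, (((x : ℂ) - w) * ((x : ℂ) - conj w))⁻¹ = ((π / w.im : ℝ) : ℂ) := by
  simp_rw [sub_mul_sub_conj, ← Complex.ofReal_inv]
  rw [integral_complex_ofReal, integral_inv_sq_add_sq hw]

/-! ### Integrability of continuous functions with quadratic decay -/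

/-- A continuous function on `ℝ` with `‖g x‖ ≤ C/x²` for `|x| ≥ R` is bounded by `B/(1 + x²)`.
[folklore] -/
private lemma exists_bound_div_one_add_sq_real {g : ℝ → ℂ} {C R : ℝ} (hg : Continuous g)
    (hb : ∀ x : ℝ, R ≤ |x| → ‖g x‖ ≤ C / x ^ 2) :
    ∃ B : ℝ, 0 ≤ B ∧ ∀ x : ℝ, ‖g x‖ ≤ B / (1 + x ^ 2) := by
  set R₁ : ℝ := max R 1 with hR₁
  have hR₁1 : 1 ≤ R₁ := le_max_right _ _
  have hR₁0 : R ≤ R₁ := le_max_left _ _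
  obtain ⟨M, hM⟩ := (isCompact_Icc (a := -R₁) (b := R₁)).exists_bound_of_continuousOn hg.continuousOn
  have hC : 0 ≤ C := by
    have h1 := hb R₁ (by rw [abs_of_pos (by linarith)]; exact hR₁0)
    have h3 : 0 < R₁ ^ 2 := by positivity
    by_contra hneg
    have hneg' : C < 0 := lt_of_not_ge hneg
    have : C / R₁ ^ 2 < 0 := div_neg_of_neg_of_pos hneg' h3
    linarith [norm_nonneg (g R₁)]
  have hM0 : 0 ≤ M := (norm_nonneg _).trans (hM 0 ⟨by linarith, by linarith⟩)
  refine ⟨max (M * (1 + R₁ ^ 2)) (2 * C), le_max_of_le_right (by positivity), fun x ↦ ?_⟩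
  have hpos : 0 < 1 + x ^ 2 := by positivity
  rw [le_div_iff₀ hpos]
  rcases le_or_gt |x| R₁ with hxR | hxR
  · have h1 : ‖g x‖ ≤ M := hM x ⟨by linarith [neg_abs_le x], by linarith [le_abs_self x]⟩
    have hx2 : x ^ 2 ≤ R₁ ^ 2 := by
      have := sq_abs x
      nlinarith [abs_nonneg x]
    calc ‖g x‖ * (1 + x ^ 2) ≤ M * (1 + R₁ ^ 2) := by
          apply mul_le_mul h1 _ hpos.le hM0
          linarith
      _ ≤ max (M * (1 + R₁ ^ 2)) (2 * C) := le_max_left _ _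
  · have hx1 : 1 ≤ |x| := hR₁1.trans hxR.le
    have hxpos : 0 < x ^ 2 := by
      have := sq_abs x; nlinarith
    have h1 : ‖g x‖ ≤ C / x ^ 2 := hb x (hR₁0.trans hxR.le)
    rw [le_div_iff₀ hxpos] at h1
    have hx2 : 1 ≤ x ^ 2 := by have := sq_abs x; nlinarith
    calc ‖g x‖ * (1 + x ^ 2) ≤ ‖g x‖ * (2 * x ^ 2) := by
          apply mul_le_mul_of_nonneg_left _ (norm_nonneg _); linarith
      _ = 2 * (‖g x‖ * x ^ 2) := by ring
      _ ≤ 2 * C := by linarith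
      _ ≤ max (M * (1 + R₁ ^ 2)) (2 * C) := le_max_right _ _

/-- A continuous function on `ℝ` with `‖g x‖ ≤ C/x²` for `|x| ≥ R` is integrable (the absolute
convergence criterion for `∫_{-∞}^{∞}`: two orders of decay). [cite: AhlforsCA1979, Ch. 4 §5.3] -/
lemma integrable_of_continuous_of_decay_sq {g : ℝ → ℂ} {C R : ℝ} (hg : Continuous g)
    (hb : ∀ x : ℝ, R ≤ |x| → ‖g x‖ ≤ C / x ^ 2) : Integrable g := by
  obtain ⟨B, -, hB⟩ := exists_bound_div_one_add_sq_real hg hb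
  exact (integrable_inv_one_add_sq.const_mul B).mono' hg.aestronglyMeasurable
    (Eventually.of_forall fun x ↦ by simpa [div_eq_mul_inv] using hB x)

/-! ### Cauchy's integral formula for the upper half-plane -/

/-- **Cauchy's integral formula for the upper half-plane.** If `h` is continuous on `{Im z ≥ 0}`,
holomorphic on `{Im z > 0}`, `‖h z‖ ≤ C/‖z‖` for `Im z ≥ 0`, `‖z‖ ≥ R₀`, and `Im w > 0`, then
`∫_ℝ h(x)/(x − w) dx = 2πi · h(w)` (Cauchy's integral formula, the contour closed in the upper
half-plane). [cite: AhlforsCA1979, Ch. 4 §2.2 Thm. 6 with Ch. 4 §5.3] -/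
theorem integral_div_sub_eq_of_upperHalfPlane {h : ℂ → ℂ} {C R₀ : ℝ} {w : ℂ}
    (hc : ContinuousOn h {z : ℂ | 0 ≤ z.im}) (hd : DifferentiableOn ℂ h {z : ℂ | 0 < z.im})
    (hb : ∀ z : ℂ, 0 ≤ z.im → R₀ ≤ ‖z‖ → ‖h z‖ ≤ C / ‖z‖) (hw : 0 < w.im) :
    ∫ x : ℝ, h x / (x - w) = 2 * π * I * h w := by
  -- notation
  set q : ℂ := conj w with hq
  have hq_im : q.im = -w.im := by simp [hq]
  have hwq : w - q ≠ 0 := by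
    intro h0
    have := congrArg Complex.im h0
    simp [hq_im] at this
    linarith
  have hzq : ∀ z : ℂ, 0 ≤ z.im → z - q ≠ 0 := by
    intro z hz h0
    have := congrArg Complex.im h0
    simp [hq_im] at this
    linarith
  have hopen : IsOpen {z : ℂ | 0 < z.im} := isOpen_lt continuous_const Complex.continuous_im
  have hwU : {z : ℂ | 0 < z.im} ∈ 𝓝 w := hopen.mem_nhds hw
  have hwU' : {z : ℂ | 0 ≤ z.im} ∈ 𝓝 w :=
    Filter.mem_of_superset hwU fun z hz ↦ by simp only [Set.mem_setOf_eq] at hz ⊢; exact hz.le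
  -- the corrected function `m` and its difference quotient `k`
  set m : ℂ → ℂ := fun z ↦ h z - h w * (w - q) / (z - q) with hm
  have hmw : m w = 0 := by
    simp only [hm]
    rw [mul_div_assoc, div_self hwq, mul_one, sub_self]
  have hm_cont : ContinuousOn m {z : ℂ | 0 ≤ z.im} := by
    refine hc.sub (continuousOn_const.div (continuousOn_id.sub continuousOn_const) ?_)
    exact fun z hz ↦ hzq z hz
  have hm_diff : DifferentiableOn ℂ m {z : ℂ | 0 < z.im} := by
    refine hd.sub (DifferentiableOn.div (differentiableOn_const _)
      (differentiableOn_id.sub (differentiableOn_const _)) ?_)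
    exact fun z hz ↦ hzq z (le_of_lt hz)
  have hm_at : DifferentiableAt ℂ m w := hm_diff.differentiableAt hwU
  set k : ℂ → ℂ := dslope m w with hk
  have hk_cont : ContinuousOn k {z : ℂ | 0 ≤ z.im} := (continuousOn_dslope hwU').2 ⟨hm_cont, hm_at⟩
  have hk_diff : DifferentiableOn ℂ k {z : ℂ | 0 < z.im} :=
    (Complex.differentiableOn_dslope hwU).2 hm_diff
  have hk_of_ne : ∀ z : ℂ, z ≠ w → k z = m z / (z - w) := by
    intro z hz
    rw [hk, dslope_of_ne _ hz, slope, hmw, vsub_eq_sub, sub_zero, smul_eq_mul, div_eq_inv_mul]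
  -- decay of `k`
  set R₁ : ℝ := max R₀ (2 * ‖w‖ + 2) with hR₁
  have hk_bound : ∀ z : ℂ, 0 ≤ z.im → R₁ ≤ ‖z‖ →
      ‖k z‖ ≤ (2 * (C + 2 * (‖h w‖ * ‖w - q‖))) / ‖z‖ ^ 2 := by
    intro z hz hzR
    have hR₀z : R₀ ≤ ‖z‖ := (le_max_left _ _).trans hzR
    have hz2 : 2 * ‖w‖ + 2 ≤ ‖z‖ := (le_max_right _ _).trans hzR
    have hzpos : 0 < ‖z‖ := by linarith [norm_nonneg w]
    have hzw : z ≠ w := by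
      intro h0; rw [h0] at hz2; linarith [norm_nonneg w]
    have hnq : ‖q‖ = ‖w‖ := by simp [hq]
    have h_zw : ‖z‖ / 2 ≤ ‖z - w‖ := by
      have := norm_sub_norm_le z w
      have h2 : ‖z‖ - ‖w‖ ≤ ‖z - w‖ := by
        have := norm_le_norm_add_norm_sub' z w  -- ‖z‖ ≤ ‖w‖ + ‖z - w‖
        linarith
      linarith
    have h_zq : ‖z‖ / 2 ≤ ‖z - q‖ := by
      have h2 : ‖z‖ - ‖q‖ ≤ ‖z - q‖ := by
        have := norm_le_norm_add_norm_sub' z q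
        linarith
      rw [hnq] at h2
      linarith
    have hzw_pos : 0 < ‖z - w‖ := by linarith
    have hzq_pos : 0 < ‖z - q‖ := by linarith
    -- bound for `m z`
    have hm_le : ‖m z‖ ≤ C / ‖z‖ + ‖h w‖ * ‖w - q‖ * (2 / ‖z‖) := by
      have h1 : ‖h z‖ ≤ C / ‖z‖ := hb z hz hR₀z
      have h2 : ‖h w * (w - q) / (z - q)‖ ≤ ‖h w‖ * ‖w - q‖ * (2 / ‖z‖) := by
        rw [norm_div, norm_mul, div_eq_mul_inv]
        refine mul_le_mul_of_nonneg_left ?_ (by positivity)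
        rw [show (2 : ℝ) / ‖z‖ = (‖z‖ / 2)⁻¹ by rw [inv_div]]
        exact (inv_le_inv₀ hzq_pos (by positivity)).2 h_zq
      calc ‖m z‖ = ‖h z - h w * (w - q) / (z - q)‖ := rfl
        _ ≤ ‖h z‖ + ‖h w * (w - q) / (z - q)‖ := norm_sub_le _ _
        _ ≤ _ := add_le_add h1 h2
    rw [hk_of_ne z hzw, norm_div]
    have h3 : ‖m z‖ / ‖z - w‖ ≤ ‖m z‖ / (‖z‖ / 2) :=
      div_le_div_of_nonneg_left (norm_nonneg _) (by positivity) h_zw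
    refine h3.trans ?_
    rw [div_le_div_iff₀ (by positivity) (by positivity)]
    have h4 : ‖m z‖ * ‖z‖ ≤ C + 2 * (‖h w‖ * ‖w - q‖) := by
      have := mul_le_mul_of_nonneg_right hm_le hzpos.le
      have e : (C / ‖z‖ + ‖h w‖ * ‖w - q‖ * (2 / ‖z‖)) * ‖z‖ = C + 2 * (‖h w‖ * ‖w - q‖) := by
        field_simp
      linarith [e]
    nlinarith [norm_nonneg (m z), norm_nonneg z]
  -- Cauchy's theorem for `k`
  have hk_int : ∫ x : ℝ, k x = 0 := integral_eq_zero_of_upperHalfPlane hk_cont hk_diff hk_bound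
  -- `k x = h x/(x − w) − h w (w − q)/((x − q)(x − w))` on the real line
  have hxw : ∀ x : ℝ, (x : ℂ) ≠ w := by
    intro x h0
    have := congrArg Complex.im h0
    simp at this
    linarith
  have hxq : ∀ x : ℝ, (x : ℂ) - q ≠ 0 := fun x ↦ hzq x (by simp)
  have hk_real : ∀ x : ℝ, k x = h x / (x - w) - h w * (w - q) * (((x : ℂ) - w) * ((x : ℂ) - q))⁻¹ := by
    intro x
    rw [hk_of_ne x (hxw x)]
    simp only [hm]
    have h1 : (x : ℂ) - w ≠ 0 := sub_ne_zero.2 (hxw x)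
    field_simp
  -- integrability of the two pieces
  have hcont_h : Continuous fun x : ℝ ↦ h x :=
    hc.comp_continuous Complex.continuous_ofReal fun x ↦ by simp
  have hcont1 : Continuous fun x : ℝ ↦ h x / (x - w) :=
    hcont_h.div (by fun_prop) fun x ↦ sub_ne_zero.2 (hxw x)
  have hcont2 : Continuous fun x : ℝ ↦ (((x : ℂ) - w) * ((x : ℂ) - q))⁻¹ :=
    Continuous.inv₀ (by fun_prop) fun x ↦ mul_ne_zero (sub_ne_zero.2 (hxw x)) (hxq x)
  have hxlarge : ∀ x : ℝ, R₁ ≤ |x| → R₀ ≤ ‖(x : ℂ)‖ ∧ ‖(x : ℂ)‖ / 2 ≤ ‖(x : ℂ) - w‖ ∧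
      ‖(x : ℂ)‖ / 2 ≤ ‖(x : ℂ) - q‖ ∧ 0 < ‖(x : ℂ)‖ := by
    intro x hx
    have hxn : ‖(x : ℂ)‖ = |x| := by simp
    rw [hxn]
    have hz2 : 2 * ‖w‖ + 2 ≤ |x| := (le_max_right _ _).trans hx
    have hnq : ‖q‖ = ‖w‖ := by simp [hq]
    refine ⟨(le_max_left _ _).trans hx, ?_, ?_, by linarith [norm_nonneg w]⟩
    · have := norm_le_norm_add_norm_sub' (x : ℂ) w
      rw [hxn] at this; linarith
    · have := norm_le_norm_add_norm_sub' (x : ℂ) q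
      rw [hxn, hnq] at this; linarith
  have hint1 : Integrable fun x : ℝ ↦ h x / (x - w) := by
    refine integrable_of_continuous_of_decay_sq (C := 2 * C) (R := R₁) hcont1 fun x hx ↦ ?_
    obtain ⟨hR₀x, hxw', -, hxpos⟩ := hxlarge x hx
    have hxn : ‖(x : ℂ)‖ = |x| := by simp
    have h1 : ‖h x‖ ≤ C / ‖(x : ℂ)‖ := hb x (by simp) hR₀x
    rw [norm_div]
    have hxw_pos : 0 < ‖(x : ℂ) - w‖ := by linarith
    calc ‖h ↑x‖ / ‖(x : ℂ) - w‖ ≤ (C / ‖(x : ℂ)‖) / (‖(x : ℂ)‖ / 2) :=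
          div_le_div₀ ((norm_nonneg _).trans h1) h1 (by positivity) hxw'
      _ = 2 * C / x ^ 2 := by
          have hx0 : |x| ≠ 0 := by rw [← hxn]; exact hxpos.ne'
          rw [hxn, ← sq_abs x]; field_simp
  have hint2 : Integrable fun x : ℝ ↦ (((x : ℂ) - w) * ((x : ℂ) - q))⁻¹ := by
    refine integrable_of_continuous_of_decay_sq (C := 4) (R := R₁) hcont2 fun x hx ↦ ?_
    obtain ⟨-, hxw', hxq', hxpos⟩ := hxlarge x hx
    have hxn : ‖(x : ℂ)‖ = |x| := by simp
    rw [norm_inv, norm_mul]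
    have : (|x| / 2) * (|x| / 2) ≤ ‖(x : ℂ) - w‖ * ‖(x : ℂ) - q‖ := by
      rw [hxn] at hxw' hxq'
      exact mul_le_mul hxw' hxq' (by positivity) (by linarith)
    rw [hxn] at hxpos
    calc (‖(x : ℂ) - w‖ * ‖(x : ℂ) - q‖)⁻¹ ≤ ((|x| / 2) * (|x| / 2))⁻¹ :=
          (inv_le_inv₀ (lt_of_lt_of_le (by positivity) this) (by positivity)).2 this
      _ = 4 / x ^ 2 := by
          have hx0 : |x| ≠ 0 := hxpos.ne'
          rw [← sq_abs x]; field_simp; norm_num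
  -- put everything together
  have hsplit : ∫ x : ℝ, k x = (∫ x : ℝ, h x / (x - w)) -
      h w * (w - q) * ∫ x : ℝ, (((x : ℂ) - w) * ((x : ℂ) - q))⁻¹ := by
    simp_rw [hk_real]
    rw [integral_sub hint1 (hint2.const_mul _), integral_const_mul]
  have hval : ∫ x : ℝ, (((x : ℂ) - w) * ((x : ℂ) - q))⁻¹ = ((π / w.im : ℝ) : ℂ) :=
    integral_inv_sub_mul_sub_conj hw
  rw [hk_int, hval] at hsplit
  have hwq' : w - q = ((2 * w.im : ℝ) : ℂ) * I := by
    apply Complex.ext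
    · simp [hq]
    · simp [hq]; ring
  have hfin : h w * (w - q) * ((π / w.im : ℝ) : ℂ) = 2 * π * I * h w := by
    rw [hwq']
    have hne : (w.im : ℂ) ≠ 0 := Complex.ofReal_ne_zero.2 hw.ne'
    push_cast
    field_simp
  rw [hfin] at hsplit
  linear_combination -hsplit

end Literature.Analysis.Complex
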